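import Summits.KontsevichZagierPeriods.KontsevichZagierPeriods.Theorems.SoloBlindSecondForm
import Summits.KontsevichZagierPeriods.KontsevichZagierPeriods.Theorems.SoloBlindCyclicSemialgebraic
import HarnessLib

/-!
# The second-kind form, III: semialgebraicity

For rational exponents `α = k/N - 1`, `β = l/N - 1` (so `σ = α + β = (k+l)/N - 2`) and real
algebraic constants `λ, μ`, the real and imaginary parts of
`g(x+iy) = z^α (1-z)^β - λ z^σ - μ (1-z)^σ` and the real part of `g'(x+iy)` are
`ℚ`-semialgebraic functions of `(x, y)` on `Eup`: `z^σ = (z^{1/N})^{k+l} z⁻²` with the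
semialgebraic `N`-th root of `SoloBlindNthRoot`, and an algebraic real constant is a
`ℚ`-semialgebraic function (`isSemialgebraicFunOn_const_of_isAlgebraic`).

References: Bochnak–Coste–Roy, *Real Algebraic Geometry*, Prop. 2.2.6 and §2.9.
-/

noncomputable section

open Set Complex MvPolynomial
open scoped ComplexConjugate
open Literature.NumberTheory.Transcendental
open Literature.ModelTheory.ExponentialFields

namespace Summit.KontsevichZagierPeriods.KontsevichZagierPeriods.Theorems

namespace SoloBlind

/-! ## The exponent `σ = α + β` -/

/-- `k/N - 1 + (l/N - 1) = ((k+l)/N - 1) - 1`. -/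
theorem cycExp_add (N k l : ℕ) : cycExp N k + cycExp N l = cycExp N (k + l) - 1 := by
  simp only [cycExp]; push_cast; ring

/-- `σ` as a cast rational. -/
theorem cycExp_add_cast (N k l : ℕ) :
    ((((k : ℚ) / N - 1 + ((l : ℚ) / N - 1) : ℚ)) : ℝ) = cycExp N k + cycExp N l := by
  simp only [cycExp]; push_cast; ring

/-- `ζ^σ = ζ^{(k+l)/N - 1} · ζ⁻¹`. -/
theorem cpow_sigma_eq {N : ℕ} (k l : ℕ) {ζ : ℂ} (hζ : ζ ≠ 0) :
    ζ ^ ((cycExp N k + cycExp N l : ℝ) : ℂ) = ζ ^ ((cycExp N (k + l) : ℝ) : ℂ) * ζ⁻¹ := by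
  rw [cycExp_add, ofReal_sub, ofReal_one, cpow_sub _ _ hζ, cpow_one, div_eq_mul_inv]

/-- `ζ^{σ-1} = ζ^σ · ζ⁻¹`. -/
theorem cpow_sigma_sub_one_eq {ζ : ℂ} (hζ : ζ ≠ 0) (σ : ℝ) :
    ζ ^ ((σ : ℂ) - 1) = ζ ^ (σ : ℂ) * ζ⁻¹ := by
  rw [cpow_sub _ _ hζ, cpow_one, div_eq_mul_inv]

/-- `1 - ζ ≠ 0` on `Eup`. -/
theorem one_sub_zeta_ne_zero {z : Fin 2 → ℝ} (hz : z ∈ Eup) : 1 - ((z 0 : ℂ) + z 1 * I) ≠ 0 := by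
  rw [one_sub_zeta_eq]
  exact (map_ne_zero_iff _ (RingHom.injective _)).mpr (mirror_ne_zero hz).1

/-! ## Semialgebraic pieces -/

/-- The coordinate functions `Re ζ`, `Im ζ`, `Re (1-ζ)`, `Im (1-ζ)` on `Eup`. -/
theorem sa_coords :
    (IsSemialgebraicFunOn ℚ Eup fun z => ((z 0 : ℂ) + z 1 * I).re) ∧
    (IsSemialgebraicFunOn ℚ Eup fun z => ((z 0 : ℂ) + z 1 * I).im) ∧
    (IsSemialgebraicFunOn ℚ Eup fun z => (1 - ((z 0 : ℂ) + z 1 * I)).re) ∧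
    (IsSemialgebraicFunOn ℚ Eup fun z => (1 - ((z 0 : ℂ) + z 1 * I)).im) :=
  ⟨(isSemialgebraicFunOn_aeval isSemialgebraic_Eup (X 0 : MvPolynomial (Fin 2) ℚ)).congr
      fun z _ => by simp,
    (isSemialgebraicFunOn_aeval isSemialgebraic_Eup (X 1 : MvPolynomial (Fin 2) ℚ)).congr
      fun z _ => by simp,
    (isSemialgebraicFunOn_aeval isSemialgebraic_Eup (1 - X 0 : MvPolynomial (Fin 2) ℚ)).congr
      fun z _ => by simp,
    (isSemialgebraicFunOn_aeval isSemialgebraic_Eup (-X 1 : MvPolynomial (Fin 2) ℚ)).congr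
      fun z _ => by simp⟩

/-- An algebraic real constant, as a complex-valued function. -/
theorem sa_const_alg {c : ℝ} (hc : IsAlgebraic ℚ c) :
    (IsSemialgebraicFunOn ℚ Eup fun _ : Fin 2 → ℝ => ((c : ℝ) : ℂ).re) ∧
      (IsSemialgebraicFunOn ℚ Eup fun _ : Fin 2 → ℝ => ((c : ℝ) : ℂ).im) :=
  sa_ofReal (isSemialgebraicFunOn_const_of_isAlgebraic isSemialgebraic_Eup hc)

/-- The constant `σ = α + β` (a rational). -/
theorem sa_const_sigma (N k l : ℕ) :
    (IsSemialgebraicFunOn ℚ Eup fun _ : Fin 2 → ℝ => (((cycExp N k + cycExp N l : ℝ)) : ℂ).re) ∧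
      (IsSemialgebraicFunOn ℚ Eup fun _ : Fin 2 → ℝ =>
        (((cycExp N k + cycExp N l : ℝ)) : ℂ).im) :=
  sa_ofReal ((isSemialgebraicFunOn_const_ratCast isSemialgebraic_Eup
    ((k : ℚ) / N - 1 + ((l : ℚ) / N - 1))).congr (g := fun _ => cycExp N k + cycExp N l)
    fun _ _ => cycExp_add_cast N k l)

/-- Real and imaginary parts of `ζ^σ` on `Eup`. -/
theorem sa_cpow_sigma {N : ℕ} (hN : 2 ≤ N) (k l : ℕ) :
    (IsSemialgebraicFunOn ℚ Eup fun z =>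
        (((z 0 : ℂ) + z 1 * I) ^ ((cycExp N k + cycExp N l : ℝ) : ℂ)).re) ∧
      (IsSemialgebraicFunOn ℚ Eup fun z =>
        (((z 0 : ℂ) + z 1 * I) ^ ((cycExp N k + cycExp N l : ℝ) : ℂ)).im) := by
  obtain ⟨hpr, hpi⟩ := sa_cpow_cycExp hN (k + l)
  obtain ⟨hlr, hli, -, -⟩ := sa_coords
  obtain ⟨hir, hii⟩ := sa_inv hlr hli
  obtain ⟨hmr, hmi⟩ := sa_mul hpr hpi hir hii
  exact ⟨hmr.congr fun z hz => by rw [cpow_sigma_eq k l (zeta_ne_zero hz)],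
    hmi.congr fun z hz => by rw [cpow_sigma_eq k l (zeta_ne_zero hz)]⟩

/-- Real and imaginary parts of `(1-ζ)^σ` on `Eup`. -/
theorem sa_one_sub_cpow_sigma {N : ℕ} (hN : 2 ≤ N) (k l : ℕ) :
    (IsSemialgebraicFunOn ℚ Eup fun z =>
        ((1 - ((z 0 : ℂ) + z 1 * I)) ^ ((cycExp N k + cycExp N l : ℝ) : ℂ)).re) ∧
      (IsSemialgebraicFunOn ℚ Eup fun z =>
        ((1 - ((z 0 : ℂ) + z 1 * I)) ^ ((cycExp N k + cycExp N l : ℝ) : ℂ)).im) := by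
  obtain ⟨hpr, hpi⟩ := sa_one_sub_cpow_cycExp hN (k + l)
  obtain ⟨-, -, hlr, hli⟩ := sa_coords
  obtain ⟨hir, hii⟩ := sa_inv hlr hli
  obtain ⟨hmr, hmi⟩ := sa_mul hpr hpi hir hii
  exact ⟨hmr.congr fun z hz => by rw [cpow_sigma_eq k l (one_sub_zeta_ne_zero hz)],
    hmi.congr fun z hz => by rw [cpow_sigma_eq k l (one_sub_zeta_ne_zero hz)]⟩

/-! ## Semialgebraicity of `g` and of `Re g'` -/

/-- **Real and imaginary parts of `g(x+iy)` are `ℚ`-semialgebraic on `Eup`** (rational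
exponents, algebraic `λ, μ`). -/
theorem sa_gK {N : ℕ} (hN : 2 ≤ N) (k l : ℕ) {lam mu : ℝ} (hlam : IsAlgebraic ℚ lam)
    (hmu : IsAlgebraic ℚ mu) :
    (IsSemialgebraicFunOn ℚ Eup fun z =>
        (gK (cycExp N k) (cycExp N l) lam mu ((z 0 : ℂ) + z 1 * I)).re) ∧
      (IsSemialgebraicFunOn ℚ Eup fun z =>
        (gK (cycExp N k) (cycExp N l) lam mu ((z 0 : ℂ) + z 1 * I)).im) := by
  obtain ⟨hgr, hgi⟩ := sa_gTwo hN k l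
  obtain ⟨h1r, h1i⟩ := sa_cpow_sigma hN k l
  obtain ⟨h2r, h2i⟩ := sa_one_sub_cpow_sigma hN k l
  obtain ⟨hl1, hl2⟩ := sa_const_alg hlam
  obtain ⟨hm1, hm2⟩ := sa_const_alg hmu
  obtain ⟨hAr, hAi⟩ := sa_mul hl1 hl2 h1r h1i
  obtain ⟨hBr, hBi⟩ := sa_mul hm1 hm2 h2r h2i
  obtain ⟨hCr, hCi⟩ := sa_sub hgr hgi hAr hAi
  obtain ⟨hr, hi⟩ := sa_sub hCr hCi hBr hBi
  exact ⟨hr.congr fun z _ => by rw [gK], hi.congr fun z _ => by rw [gK]⟩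

/-- `g'` in product form off `{0, 1}`. -/
theorem gKDer_eq_prod {α β : ℝ} (lam mu : ℝ) {ζ : ℂ} (h0 : ζ ≠ 0) (h1 : 1 - ζ ≠ 0) :
    gKDer α β lam mu ζ = gTwoDer α β ζ -
      ((lam : ℂ) * (((α + β : ℝ) : ℂ) * (ζ ^ ((α + β : ℝ) : ℂ) * ζ⁻¹)) -
        (mu : ℂ) * (((α + β : ℝ) : ℂ) * ((1 - ζ) ^ ((α + β : ℝ) : ℂ) * (1 - ζ)⁻¹))) := by
  rw [gKDer, cpow_sigma_sub_one_eq h0, cpow_sigma_sub_one_eq h1]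
  ring

/-- **The real part of `g'(x+iy)` is `ℚ`-semialgebraic on `Eup`.** -/
theorem sa_re_gKDer {N : ℕ} (hN : 2 ≤ N) (k l : ℕ) {lam mu : ℝ} (hlam : IsAlgebraic ℚ lam)
    (hmu : IsAlgebraic ℚ mu) :
    IsSemialgebraicFunOn ℚ Eup fun z =>
      (gKDer (cycExp N k) (cycExp N l) lam mu ((z 0 : ℂ) + z 1 * I)).re := by
  have hD := sa_re_gTwoDer hN k l
  obtain ⟨hlr, hli, hmr, hmi⟩ := sa_coords
  obtain ⟨h1r, h1i⟩ := sa_cpow_sigma hN k l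
  obtain ⟨h2r, h2i⟩ := sa_one_sub_cpow_sigma hN k l
  obtain ⟨hl1, hl2⟩ := sa_const_alg hlam
  obtain ⟨hm1, hm2⟩ := sa_const_alg hmu
  obtain ⟨hs1, hs2⟩ := sa_const_sigma N k l
  obtain ⟨hizr, hizi⟩ := sa_inv hlr hli
  obtain ⟨himr, himi⟩ := sa_inv hmr hmi
  obtain ⟨hP1r, hP1i⟩ := sa_mul h1r h1i hizr hizi
  obtain ⟨hP2r, hP2i⟩ := sa_mul h2r h2i himr himi
  obtain ⟨hQ1r, hQ1i⟩ := sa_mul hs1 hs2 hP1r hP1i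
  obtain ⟨hQ2r, hQ2i⟩ := sa_mul hs1 hs2 hP2r hP2i
  obtain ⟨hR1r, hR1i⟩ := sa_mul hl1 hl2 hQ1r hQ1i
  obtain ⟨hR2r, hR2i⟩ := sa_mul hm1 hm2 hQ2r hQ2i
  obtain ⟨hSr, hSi⟩ := sa_sub hR1r hR1i hR2r hR2i
  -- `Im gTwoDer` is not needed: `Re (A - S) = Re A - Re S`
  refine ((hD.fun_sub hSr).congr fun z hz => ?_)
  rw [gKDer_eq_prod lam mu (zeta_ne_zero hz) (one_sub_zeta_ne_zero hz)]
  simp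

end SoloBlind

end Summit.KontsevichZagierPeriods.KontsevichZagierPeriods.Theorems
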